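import Summits.QuantumFields.YangMills.Theorems.F4SubCurvatureDoorShortRootRigidityPlanarRigidity
import Mathlib
import HarnessLib

/-!
# SUB-LINE g22-A «HERMITIAN SLICE» for the registered stub `:146 stub_oddModeRigidity` of the skeleton of record
# `Cruxes/ShortRootRigidity/Lines/aperture_bootstrap.lean` (cba045e6138d) — crux ⟨stmt-QuantumFields-23035⟩ `F4SubCurvatureDoor.ShortRootRigidity`

Ideator seat `ym-idea-3`, generation g22 (technique card: positivity / convexity).  An ALTERNATIVE to the typed split
`Lines/odd_mode_split.lean` (`AnalyticHalf ∧ TorusReduction ∧ TrigonalInjectivityAll ⇒ OddModeRigidity`) that uses NO spherical harmonics,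
NO `W(F₄)`/`O_h` invariant theory and NO trigonal arithmetic: it proves the CONCLUSION of `OddModeRigidity` (global `O(4)`-invariance of every
`InClass` kernel) from four pieces and never touches its hypothesis `EvenPartSliceInvariant`.

THE LEVER.  Why does the real slice theory (✓`SliceInClass`, ✓`planarRigidity_holds`, ✓`SliceDensity`) only see the SYMMETRISED kernel
`K(ιy + ι^⊥x) + K(−ιy + ι^⊥x)`?  Because a REAL reflection-positive transverse weight `w` must be positive-definite, hence EVEN, and then
`y ↦ ∫ K(ιy + ι^⊥x) w(x) dx` is automatically even in `y`.  A COMPLEX positive-definite weight is not even: the Gaussian characters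
`w_a(x) = e^{i⟪a,x⟫} e^{−‖x‖²/2}` (`a ∈ ℝ²`; positive-definite since `x ↦ e^{i⟪a,x⟫}` is a character) give COMPLEX slices
`S_a(y) = ∫ K(ιy + ι^⊥x) w_a(x) dx` which are HERMITIAN reflection-positive planar kernels (`Σ c̄ᵢ cⱼ S_a(θyᵢ − yⱼ) ≥ 0` for complex `c`),
`D₃`-symmetric (`σ_{e₀}`, `σ_{n₂}` fix `Π₀^⊥` pointwise), Hermitian (`S_a(−y) = conj S_a(y)`), with the planar budget `‖y‖⁶ S_a → 0`, and whose
frame Laplace–Fourier measure is an explicit POSITIVE push-forward of the 4-D one (pattern of ✓p726211 `exists_isPlanarLF_slice`).  Their family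
over all `a ∈ ℝ²` determines `x ↦ K(ιy + ι^⊥x)` itself (Fourier uniqueness of an `L¹` continuous function — NO symmetrisation).

THE FOUR PIECES (stubs below; sizes are guesses):
* H1 `HermitianSliceInClass` (M−, a variant of ✓`stub_sliceInClass` + ✓`exists_isPlanarLF_slice`): every complex slice `sliceC K a` of an `InClass`
  kernel lies in the HERMITIAN PLANAR CLASS `InHermitianPlanarClass` (continuous off `0`, bounded off the disc, `σ_{e₀}`- and `hexReflection`-invariant,
  an explicit positive frame Laplace–Fourier measure in the complex form `k(t,s) = ∫ e^{−tE} e^{isp} dμ` (`t > 0`), budget `‖y‖⁶‖k‖ → 0`).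
* H2 `HermitianPlanarRigidity` (L — THE HEART, new): every kernel of the Hermitian planar class is `O(2)`-invariant off `0`.  PLAN (card §Hardest stub):
  (i) `Re k ∈ InPlanarClass` with `IsPlanarLF (Re k) μ` for the SAME `μ` ⇒ `HasAperture μ 1` by ✓`planarConeSupport_holds` and `Re k` radial by
  ✓`planarRigidity_holds`; (ii) ANGULAR CONTINUATION as in ✓`stub_angularContinuation` but with SIX charts of which the odd ones are CONJUGATED
  (`k(−y) = conj k(y)`): `φ ↦ k(polar r φ)` is the restriction of an entire `G`, `G(z + 2π/3) = G(z)` (only `D₃`, not `D₆`), `‖G(φ + iψ)‖ = o(e^{6|ψ|})`;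
  (iii) THREE-MODE RIGIDITY (variant of ✓`stub_periodicEntireRigidity`): such a `G` is `c₀ + c₊ e^{3iz} + c₋ e^{−3iz}` — the budget kills every
  angular mode `|n| ≥ 6` but NOT `n = ±3` (`K₃(mr) sin 3φ ~ r⁻³` is inside the budget), and `Re k` radial + Hermitian give `c₋ = −c₊` only;
  (iv) BOOST POSITIVITY (new, elementary): the boosted measures `μ_τ := (Φ_τ)_*μ`, `Φ_τ(E,p) = (E ch τ + p sh τ, E sh τ + p ch τ)`, are POSITIVE and
  their complex Laplace–Fourier transforms are the values of the tube extension at the complex-rotated points `R_{iτ}(t,s)` (a one-line change of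
  variables), i.e. `LF[μ_τ](polar r φ) = G_r(φ + iτ) = c₀(r) + e^{−3τ} c₊(r) e^{3iφ} + e^{3τ} c₋(r) e^{−3iφ}`; solving the `3 × 3` Vandermonde system in
  `(1, e^{−3τ}, e^{3τ})` writes the three mode functions as transforms of SIGNED measures `λ₀, λ₊, λ₋`, uniqueness gives `μ_σ = λ₀ + e^{−3σ}λ₊ + e^{3σ}λ₋`
  for all `σ`, positivity of every `μ_σ` forces `λ₊ ≥ 0` AND `λ₋ ≥ 0`, while `c₋ = −c₊` reads `λ₋ = −(λ₊)ˇ ≤ 0` (`ˇ` = `p ↦ −p`); hence `λ₊ = λ₋ = 0`,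
  `k = c₀(r)` on the half plane, and `k` is radial off `0` by `σ_{e₀}` and continuity.
* H3 `CharacterSliceUniqueness` (S): if all complex slices are invariant at `y ≠ 0` then `K(ι(Ry) + ι^⊥x) = K(ιy + ι^⊥x)` for every `x`
  (the Gaussian-damped continuous integrable `x ↦ K(ιy + ι^⊥x) e^{−‖x‖²/2}` is determined by its Fourier transform:
  `Literature.Analysis.Fourier.ae_eq_zero_of_forall_fourier_eq_zero` + continuity; cf. ✓`F4SubCurvatureDoorSliceFourierUniqueness` for the cosine case).
* H4 `CircleToSphere` (S–M, elementary): a kernel continuous off `0`, `W(B₄)`-invariant and invariant under the rotations of the hexagonal plane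
  `Π₀ = span(e₀, (0,1,1,1)/√3)` (acting as `R ⊕ id` on `Π₀ ⊕ Π₀^⊥`) is `O(4)`-invariant: flip signs so that `x⃗ ≥ 0`, rotate in `Π₀` to kill the
  `(0,1,1,1)`-component — `‖x⃗′‖² = ‖x⃗‖² − (x⃗·d)² ≤ (2/3)‖x⃗‖²` since `x⃗ ≥ 0 ⇒ x⃗·d ≥ ‖x⃗‖/√3` — and iterate: the orbit point converges to `‖x‖e₀ ≠ 0`,
  where `K` is continuous, so `K x = K(‖x‖ e₀)`.
COMPOSITION (PROVED below, kernel-checked): `H1 → H2 → H3 → H4 → OddModeRigidity` (`oddModeRigidity_of_hermitian`; the hypothesis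
`EvenPartSliceInvariant` is simply not used), hence the crux BY NAME through ✓`shortRootRigidity_of_oddModeRigidity`
(`ShortRootRigidity_of_hermitianSlice`, the only hypothesis-free theorem of this file concluding the crux).  NOT registered with `skeleton check`
(the skeleton of record and its one active stub `:146` stay as they are); provers land H1–H4 `--supports stmt-QuantumFields-23035 --as helper` and then
`:146` BY NAME via `oddModeRigidity_of_hermitian`.  INSURANCE for `:146`, not a competitor of the trigonal chain (`Lines/trigonal_injectivity.lean`).
HONEST LABEL: a skeleton; H1–H4, `OddModeRigidity`, ⟨23035⟩, ⟨23125⟩, R2d and the Yang–Mills mass gap are OPEN; no summit and no rung is proved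
by this file; no summit is proved by a line.
-/

noncomputable section

namespace Summit.QuantumFields.YangMills.Cruxes.ShortRootRigidity.HermitianSlice

open scoped Topology BigOperators RealInnerProductSpace
open Filter Set MeasureTheory
open Literature.MathematicalPhysics.QuantumLattice (timeReflection siteToE)
open Summit.QuantumFields.YangMills.Cruxes.OSLegsAtWeakCouplingC.Sketch (IsSignedPerm)
open Summit.QuantumFields.YangMills.Theorems.F4SubCurvatureDoorMirrorAnalyticityRegistered (E4 InClass)
open Summit.QuantumFields.YangMills.Theorems.F4SubCurvatureDoorSliceDensityRegistered
  (E2 planeEmb perpEmb slice EvenPartSliceInvariant SliceDensity stub_sliceDensity)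
open Summit.QuantumFields.YangMills.Theorems.F4SubCurvatureDoorSliceInClassRegistered
  (hexReflection InPlanarClass SliceInClass stub_sliceInClass)
open Summit.QuantumFields.YangMills.Theorems.F4SubCurvatureDoorPlanarFrameTimeHolomorphyRegistered (mk2)
open Summit.QuantumFields.YangMills.Theorems.F4SubCurvatureDoorPlanarInitialApertureRegistered (IsPlanarLF HasAperture)
open Summit.QuantumFields.YangMills.Theses.F4SubCurvatureDoor (ShortRootRigidity)
open Summit.QuantumFields.YangMills.Theorems.F4SubCurvatureDoorPlanarRigidityByName
  (planarRigidity_holds shortRootRigidity_of_oddModeRigidity)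

/-! ## Vocabulary -/

/-- The Gaussian CHARACTER weight `w_a(x) = e^{i⟪a,x⟫} e^{−‖x‖²/2}` — complex, positive-definite, NOT even. [problem-side definition] -/
def weightC (a x : E2) : ℂ :=
  Complex.exp (((inner ℝ a x : ℝ) : ℂ) * Complex.I) * ((Real.exp (-(‖x‖ ^ 2 / 2)) : ℝ) : ℂ)

/-- The complex transverse slice `S_a(y) = ∫ K(ι y + ι^⊥ x) w_a(x) dx` along the hexagonal plane `Π₀`. [problem-side definition] -/
def sliceC (K : E4 → ℝ) (a : E2) (y : E2) : ℂ :=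
  ∫ x : E2, ((K (planeEmb y + perpEmb x) : ℝ) : ℂ) * weightC a x

/-- `μ` is a frame Laplace–Fourier measure of the complex planar kernel `k` in the frame `e₀`, complex form:
`k(t,s) = ∫ e^{−tE} e^{isp} dμ(E,p)` for `t > 0` (a POSITIVE measure on `{E ≥ 0} × ℝ`; its cosine transform represents `Re k`, so
`IsPlanarLF (Re ∘ k) μ` in the tree's sense). [problem-side definition] -/
def IsHermitianPlanarLF (k : E2 → ℂ) (μ : Measure (ℝ × ℝ)) : Prop :=
  μ (Set.Iio 0 ×ˢ Set.univ) = 0 ∧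
    ∀ t : ℝ, 0 < t → Integrable (fun z : ℝ × ℝ => Real.exp (-(t * z.1))) μ ∧
      ∀ x : ℝ, k (mk2 t x) = ∫ z, ((Real.exp (-(z.1 * t)) : ℝ) : ℂ) * Complex.exp (((z.2 * x : ℝ) : ℂ) * Complex.I) ∂μ

/-- THE HERMITIAN PLANAR CLASS: `k : ℝ² → ℂ` continuous off `0`, bounded outside the unit disc, invariant under the TRIANGLE group
`D₃ = ⟨θ₂, σ_{n'}⟩` (NOT under `−1`: instead `k(−y) = conj (k y)`, which follows from the representation), represented in the frame `e₀` by a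
positive Laplace–Fourier measure in complex form, with the planar budget `‖y‖⁶ ‖k y‖ → 0`. [problem-side definition] -/
def InHermitianPlanarClass (k : E2 → ℂ) : Prop :=
  ContinuousOn k {y | y ≠ 0} ∧
  (∃ C : ℝ, ∀ y, 1 ≤ ‖y‖ → ‖k y‖ ≤ C) ∧
  (∀ y, k (timeReflection 2 y) = k y) ∧
  (∀ y, k (hexReflection y) = k y) ∧
  (∃ μ : Measure (ℝ × ℝ), IsHermitianPlanarLF k μ) ∧
  Tendsto (fun y : E2 => ‖y‖ ^ 6 * ‖k y‖) (𝓝[≠] 0) (𝓝 0)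

/-- Obligation (4) «ODD-MODE RIGIDITY» (verbatim, the registered stub `:146` of `Lines/aperture_bootstrap.lean`). [problem-side definition] -/
def OddModeRigidity : Prop :=
  ∀ K : E4 → ℝ, InClass K → EvenPartSliceInvariant K → ∀ (R : E4 ≃ₗᵢ[ℝ] E4) (x : E4), K (R x) = K x

/-! ## The four pieces -/

/-- **H1 «HERMITIAN SLICES ARE HERMITIAN PLANAR KERNELS»** (M−). [problem-side statement] -/
def HermitianSliceInClass : Prop :=
  ∀ K : E4 → ℝ, InClass K → ∀ a : E2, InHermitianPlanarClass (sliceC K a)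

/-- **H2 «HERMITIAN PLANAR RIGIDITY»** (L — the heart): every kernel of the Hermitian planar class is `O(2)`-invariant off `0`.
WHY IT MIGHT FAIL: the odd angular modes `n ≡ 3 (mod 6)` of lowest order (`b(r) sin 3φ`, `r⁻³`) survive the growth argument and must be killed by
positivity of the boosted frame measures (plan (iv) of the module docstring); the chart bookkeeping with conjugated odd charts is new. -/
def HermitianPlanarRigidity : Prop :=
  ∀ k : E2 → ℂ, InHermitianPlanarClass k → ∀ (R : E2 ≃ₗᵢ[ℝ] E2) (y : E2), y ≠ 0 → k (R y) = k y

/-- **H3 «CHARACTER SLICES DETERMINE THE KERNEL ON THE AFFINE PLANES `ιy + Π₀^⊥`»** (S): Fourier uniqueness, no symmetrisation. -/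
def CharacterSliceUniqueness : Prop :=
  ∀ K : E4 → ℝ, InClass K → ∀ (R : E2 ≃ₗᵢ[ℝ] E2) (y : E2), y ≠ 0 →
    (∀ a : E2, sliceC K a (R y) = sliceC K a y) → ∀ x : E2, K (planeEmb (R y) + perpEmb x) = K (planeEmb y + perpEmb x)

/-- **H4 «CIRCLE TO SPHERE»** (S–M, elementary iteration): `W(B₄)` and the rotations of ONE hexagonal plane act transitively enough. -/
def CircleToSphere : Prop :=
  ∀ K : E4 → ℝ, ContinuousOn K {x | x ≠ 0} →
    (∀ R : E4 ≃ₗᵢ[ℝ] E4, IsSignedPerm R → ∀ x, K (R x) = K x) →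
    (∀ (R : E2 ≃ₗᵢ[ℝ] E2) (y x : E2), y ≠ 0 → K (planeEmb (R y) + perpEmb x) = K (planeEmb y + perpEmb x)) →
    ∀ (R : E4 ≃ₗᵢ[ℝ] E4) (x : E4), K (R x) = K x

/-! ## Stubs (sorried — exactly these four; NOT registered: the skeleton of record keeps its one active stub `:146`) -/

/-- Stub H1 «HERMITIAN SLICE IN CLASS». [problem-side stub] -/
theorem stub_hermitianSliceInClass : HermitianSliceInClass := by
  sorry

/-- Stub H2 «HERMITIAN PLANAR RIGIDITY» (the heart). [problem-side stub] -/
theorem stub_hermitianPlanarRigidity : HermitianPlanarRigidity := by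
  sorry

/-- Stub H3 «CHARACTER SLICE UNIQUENESS». [problem-side stub] -/
theorem stub_characterSliceUniqueness : CharacterSliceUniqueness := by
  sorry

/-- Stub H4 «CIRCLE TO SPHERE». [problem-side stub] -/
theorem stub_circleToSphere : CircleToSphere := by
  sorry

/-! ## Composition (proved) -/

/-- Full (un-symmetrised) slice invariance along `Π₀` from H1–H3. [problem-side composition] -/
theorem fullSliceInvariance_of_pieces (h1 : HermitianSliceInClass) (h2 : HermitianPlanarRigidity)
    (h3 : CharacterSliceUniqueness) (K : E4 → ℝ) (hK : InClass K) :
    ∀ (R : E2 ≃ₗᵢ[ℝ] E2) (y x : E2), y ≠ 0 → K (planeEmb (R y) + perpEmb x) = K (planeEmb y + perpEmb x) :=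
  fun R y x hy => h3 K hK R y hy (fun a => h2 (sliceC K a) (h1 K hK a) R y hy) x

/-- Global `O(4)`-invariance of every `InClass` kernel from H1–H4. [problem-side composition] -/
theorem global_of_pieces (h1 : HermitianSliceInClass) (h2 : HermitianPlanarRigidity) (h3 : CharacterSliceUniqueness)
    (h4 : CircleToSphere) : ∀ K : E4 → ℝ, InClass K → ∀ (R : E4 ≃ₗᵢ[ℝ] E4) (x : E4), K (R x) = K x :=
  fun K hK => h4 K hK.1 hK.2.2.1 (fullSliceInvariance_of_pieces h1 h2 h3 K hK)

/-- **The registered stub `:146` from the four pieces** (its hypothesis `EvenPartSliceInvariant` is not needed). [problem-side composition] -/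
theorem oddModeRigidity_of_hermitian (h1 : HermitianSliceInClass) (h2 : HermitianPlanarRigidity) (h3 : CharacterSliceUniqueness)
    (h4 : CircleToSphere) : OddModeRigidity :=
  fun K hK _ => global_of_pieces h1 h2 h3 h4 K hK

/-- The crux from the four pieces as hypotheses (for by-name landings in any order). [problem-side composition] -/
theorem shortRootRigidity_of_hermitian (h1 : HermitianSliceInClass) (h2 : HermitianPlanarRigidity) (h3 : CharacterSliceUniqueness)
    (h4 : CircleToSphere) : ShortRootRigidity :=
  shortRootRigidity_of_oddModeRigidity (oddModeRigidity_of_hermitian h1 h2 h3 h4)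

/-- **Composition (kernel-checked): the four stubs imply the route crux `ShortRootRigidity` BY NAME** — the only hypothesis-free theorem
of this file concluding the crux. [problem-side composition] -/
theorem ShortRootRigidity_of_hermitianSlice : ShortRootRigidity :=
  shortRootRigidity_of_hermitian stub_hermitianSliceInClass stub_hermitianPlanarRigidity stub_characterSliceUniqueness
    stub_circleToSphere

end Summit.QuantumFields.YangMills.Cruxes.ShortRootRigidity.HermitianSlice

end
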